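import Literature.NumberTheory.EllipticCurves.MazurTorsionProofs
import HarnessLib

/-!
# The order of `E(ℚ)_tors`: annihilator bounds (unconditional) and `p`-adic valuations from Mazur's theorem

Topic `Literature/NumberTheory/EllipticCurves`; `Proofs`-style file (THEOREMS ONLY: no definition, no
named fact, no instance). Cell `b2b-bsdr2sha` (run/shared/lean/b2b/bsd-rank2-sha/), HONEST FRAMING: the
cell certifies `#Ш(E/ℚ)[p^∞]` row by row from PRINTED Iwasawa-theoretic inputs; this file proves
nothing about BSD. It supplies the elementary bookkeeping on `#E(ℚ)_tors = W.torsionOrder` that the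
cell's «w16-bound» rows with RATIONAL `p`-TORSION need (Wuthrich 2014 Thm. 16 bounds
`ord_p #Ш[p^∞]` by an expression containing `2·ord_p #E(ℚ)_tors`; RULING (47) of the cell), and that
several `Summits/BirchSwinnertonDyer/Rank1Residual` files so far carry as a HYPOTHESIS
(`¬ p² ∣ #E(ℚ)_tors`, e.g. `hsmall`/`htors` in `O6/X3KatoMemberBound`, `X1/ConstantTermSqueeze`).

## Statements (`W/ℚ` an elliptic curve, `E(ℚ) = W.toAffine.Point`, `#E(ℚ)_tors = W.torsionOrder`)

Unconditional (from the tree's discharged facts `finite_torsion_holds`, `exists_weilPairing_holds`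
through `torsion_addEquiv_zmod_or_prod_holds`: `E(ℚ)_tors ≃ ℤ/k` or `ℤ/2k × ℤ/2`):
* `torsionOrder_eq_natCard_torsion` — bookkeeping: `W.torsionOrder` (stated in file `MordellWeil`
  for every number field, hence with the classical `DecidableEq`) is `Nat.card E(ℚ)_tors` for the
  group law Mathlib elaborates over `ℚ` (`DecidableEq ℚ` is a subsingleton).
* `addOrderOf_dvd_torsionOrder`, `dvd_torsionOrder_of_nsmul_eq_zero`,
  `one_le_padicValNat_torsionOrder_of_nsmul_eq_zero` — a rational point of order `n` gives
  `n ∣ #E(ℚ)_tors`; a rational `T ≠ O` with `p·T = O` gives `p ∣ #E(ℚ)_tors`, `ord_p #E(ℚ)_tors ≥ 1`.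
* `exists_torsionOrder_eq_addOrderOf_or` — **`#E(ℚ)_tors = m` or `2m` with `m` the order of a
  rational torsion point** (a generator of `ℤ/k`, resp. `(1,0) ∈ ℤ/2k × ℤ/2`; Cremona §3.3).
* `torsionOrder_dvd_two_mul_of_nsmul_eq_zero`, `padicValNat_torsionOrder_le_of_nsmul_eq_zero` — an
  ANNIHILATOR `n` of the rational torsion (`n·P = O` for every torsion `P ∈ E(ℚ)`; e.g.
  `n = gcd_ℓ #Ẽ(𝔽_ℓ)` over good odd primes `ℓ`, Silverman AEC VII.3.1(b)) gives `#E(ℚ)_tors ∣ 2n`,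
  so `ord_p #E(ℚ)_tors ≤ ord_p n` at every odd prime `p`.
* `torsionOrder_eq_of_prime_nsmul_eq_zero` — **an odd PRIME annihilator `p` together with one
  rational `T ≠ O`, `p·T = O`, gives `#E(ℚ)_tors = p` exactly** (the soundness statement of a
  «`ℤ/p`» torsion certificate: killers with annihilator `p` + the witness point).

From MAZUR'S THEOREM in its printed order form, the tree's named fact
`Mazur1977_addOrderOf_le W` (Mazur 1977, Thm. (7') p. 35 = Cor. III.(5.2) p. 156: a rational torsion
point has order `≤ 10` or `= 12`), hypothesis `hMz`:
* `exists_torsionOrder_eq_of_mazur` — `#E(ℚ)_tors = m` or `2m` with `m ≤ 10` or `m = 12`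
  (so `#E(ℚ)_tors ≤ 24`, `torsionOrder_le_of_mazur`; the sharper list of fifteen group orders needs
  Kubert's two exclusions, `mazur_torsion_of`, and is not used here).
* `not_sq_dvd_torsionOrder_of_mazur`, `padicValNat_torsionOrder_le_one_of_mazur` — for a prime
  `p ≥ 5`: `p² ∤ #E(ℚ)_tors`, `ord_p #E(ℚ)_tors ≤ 1`.
* `padicValNat_three_torsionOrder_le_two_of_mazur`, `padicValNat_two_torsionOrder_le_four_of_mazur`
  — `ord_3 #E(ℚ)_tors ≤ 2`, `ord_2 #E(ℚ)_tors ≤ 4`.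
* `not_dvd_torsionOrder_of_mazur` — for a prime `p ≥ 11`: `p ∤ #E(ℚ)_tors`.
* `padicValNat_torsionOrder_eq_one_of_mazur_of_nsmul_eq_zero` — **for a prime `p ≥ 5` and a
  rational `T ≠ O` with `p·T = O`: `ord_p #E(ℚ)_tors = 1`** (the input of the cell's «ℤ/5» rows,
  RULING (47)(a): `b = k + 2·ord_5 #E(ℚ)_tors = k + 2`).

## References
* [Mazur1977] B. Mazur, *Modular curves and the Eisenstein ideal*, Publ. Math. IHÉS 47 (1977),
  Introduction Thm. (7') p. 35; Ch. III §5, Cor. (5.2), p. 156.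
* [CremonaAlgorithms1997] J. E. Cremona, *Algorithms for Modular Elliptic Curves*, 2nd ed. (1997),
  §3.3 p. 52 (`T ≅ C_k` or `C_{2k} × C_2`).
* [SilvermanAEC2009] J. H. Silverman, *The Arithmetic of Elliptic Curves*, 2nd ed., GTM 106 (2009),
  VII.3.1(b), VIII.7 (Thm. VIII.7.5 = Mazur).
* [Wuthrich2014] C. Wuthrich, *On the integrality of modular symbols and Kato's Euler system for
  elliptic curves*, Doc. Math. 19 (2014), Thm. 16 (p. 397), §6.
-/

noncomputable section

open WeierstrassCurve AddSubgroup

namespace Literature.NumberTheory.EllipticCurves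

/-! ### Arithmetic helpers -/

namespace TorsionOrderAux

/-- `0 < n < p^(e+1)` forces `ord_p n ≤ e` (`p ^ ord_p n ∣ n`). [folklore] -/
private theorem padicValNat_le_of_lt_pow {p n e : ℕ} [hp : Fact p.Prime] (hn : n ≠ 0)
    (h : n < p ^ (e + 1)) : padicValNat p n ≤ e := by
  by_contra hlt
  have hle : e + 1 ≤ padicValNat p n := by omega
  have hdvd : p ^ (e + 1) ∣ n := (padicValNat_dvd_iff_le hn).mpr hle
  exact absurd (Nat.le_of_dvd (Nat.pos_of_ne_zero hn) hdvd) (not_le.mpr h)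

/-- `p² ∤ n`, `n ≠ 0` ⇒ `ord_p n ≤ 1`. [folklore] -/
private theorem padicValNat_le_one_of_not_sq_dvd {p n : ℕ} [hp : Fact p.Prime] (hn : n ≠ 0)
    (h : ¬ p ^ 2 ∣ n) : padicValNat p n ≤ 1 := by
  by_contra hlt
  exact h ((padicValNat_dvd_iff_le hn).mpr (by omega))

/-- For an odd prime `p`, `ord_p (2n) = ord_p n` (`n ≠ 0`). [folklore] -/
private theorem padicValNat_two_mul_of_ne_two {p n : ℕ} [hp : Fact p.Prime] (hp2 : p ≠ 2) (hn : n ≠ 0) :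
    padicValNat p (2 * n) = padicValNat p n := by
  have h2 : ¬ p ∣ 2 := fun h =>
    hp2 ((Nat.prime_dvd_prime_iff_eq hp.out Nat.prime_two).mp h)
  rw [padicValNat.mul two_ne_zero hn, padicValNat.eq_zero_of_not_dvd h2, zero_add]

end TorsionOrderAux

open TorsionOrderAux

variable (W : WeierstrassCurve ℚ) [W.IsElliptic]

/-! ### Bookkeeping: the two `DecidableEq ℚ` instances -/

omit [W.IsElliptic] in
/-- `Nat.card E(ℚ)_tors` does not depend on the decidable-equality instance on `ℚ` used by Mathlib's
group law on affine points (`DecidableEq ℚ` is a subsingleton). [folklore] -/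
private theorem natCard_torsion_eq_of_subsingleton (d₁ d₂ : DecidableEq ℚ) :
    Nat.card (@AddCommGroup.torsion W.toAffine.Point
        (@WeierstrassCurve.Affine.Point.instAddCommGroup ℚ _ W.toAffine d₁)) =
      Nat.card (@AddCommGroup.torsion W.toAffine.Point
        (@WeierstrassCurve.Affine.Point.instAddCommGroup ℚ _ W.toAffine d₂)) := by
  obtain rfl : d₁ = d₂ := Subsingleton.elim _ _
  rfl

omit [W.IsElliptic] in
/-- **`W.torsionOrder = Nat.card E(ℚ)_tors`** for the group law Mathlib elaborates over `ℚ`: the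
tree's `WeierstrassCurve.torsionOrder` (file `MordellWeil`, any number field, classical
`DecidableEq`) names the same number (`natCard_torsion_eq_of_subsingleton`); `E(ℚ)_tors = E_tors(ℚ)` is
the torsion subgroup of Silverman AEC §VIII.7. [cite: SilvermanAEC2009, §VIII.7 (p. 240)] -/
theorem torsionOrder_eq_natCard_torsion :
    W.torsionOrder = Nat.card (AddCommGroup.torsion W.toAffine.Point) := by
  unfold WeierstrassCurve.torsionOrder
  exact natCard_torsion_eq_of_subsingleton W _ _

/-- `E(ℚ)_tors` is finite (the tree's discharged `finite_torsion_holds`, Silverman AEC §VIII.7), for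
the group law elaborated over `ℚ`. [cite: SilvermanAEC2009, §VIII.7 (p. 240)] -/
theorem finite_torsion_rat : Finite (AddCommGroup.torsion W.toAffine.Point) := by
  apply Nat.finite_of_card_ne_zero
  rw [← torsionOrder_eq_natCard_torsion]
  exact (W.torsionOrder_pos_holds).ne'

/-! ### Unconditional: divisibility by the order of a rational torsion point -/

omit [W.IsElliptic] in
/-- **The order of a rational torsion point divides `#E(ℚ)_tors`** (Lagrange in the finite group
`E(ℚ)_tors = E_tors(ℚ)` of Silverman AEC §VIII.7; `Nat.card`-divisibility, Mathlib
`addOrderOf_dvd_natCard`). [cite: SilvermanAEC2009, §VIII.7 (p. 240)] -/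
theorem addOrderOf_dvd_torsionOrder {P : W.toAffine.Point} (hP : IsOfFinAddOrder P) :
    addOrderOf P ∣ W.torsionOrder := by
  rw [torsionOrder_eq_natCard_torsion]
  have hPmem : P ∈ AddCommGroup.torsion W.toAffine.Point := hP
  rw [← AddSubgroup.addOrderOf_mk P hPmem]
  exact addOrderOf_dvd_natCard _

omit [W.IsElliptic] in
/-- **A rational `T ≠ O` with `p·T = O` (`p` prime) gives `p ∣ #E(ℚ)_tors`** (`T` has order exactly
`p`, Mathlib `addOrderOf_eq_prime`; Lagrange in `E_tors(ℚ)`, Silverman AEC §VIII.7).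
[cite: SilvermanAEC2009, §VIII.7 (p. 240)] -/
theorem dvd_torsionOrder_of_nsmul_eq_zero (p : ℕ) [hp : Fact p.Prime] {T : W.toAffine.Point}
    (hT : p • T = 0) (hT0 : T ≠ 0) : p ∣ W.torsionOrder := by
  have hord : addOrderOf T = p := addOrderOf_eq_prime hT hT0
  have hfin : IsOfFinAddOrder T := addOrderOf_pos_iff.mp (by rw [hord]; exact hp.out.pos)
  exact hord ▸ addOrderOf_dvd_torsionOrder W hfin

/-- **A rational `T ≠ O` with `p·T = O` (`p` prime) gives `ord_p #E(ℚ)_tors ≥ 1`** (`p ∣ #E(ℚ)_tors`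
and `#E(ℚ)_tors ≥ 1`, Silverman AEC §VIII.7). [cite: SilvermanAEC2009, §VIII.7 (p. 240)] -/
theorem one_le_padicValNat_torsionOrder_of_nsmul_eq_zero (p : ℕ) [Fact p.Prime]
    {T : W.toAffine.Point} (hT : p • T = 0) (hT0 : T ≠ 0) : 1 ≤ padicValNat p W.torsionOrder :=
  one_le_padicValNat_of_dvd (W.torsionOrder_pos_holds).ne' (dvd_torsionOrder_of_nsmul_eq_zero W p hT hT0)

/-! ### Unconditional: `#E(ℚ)_tors = m` or `2m`, `m` the order of a rational torsion point -/

/-- **`#E(ℚ)_tors` is the order of a rational torsion point, or twice it.** From the shape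
`E(ℚ)_tors ≃ ℤ/k` or `ℤ/2k × ℤ/2` (Cremona, *Algorithms* §3.3 p. 52; tree theorem
`torsion_addEquiv_zmod_or_prod_holds`, proved from the finiteness of `E(ℚ)_tors` and the Weil
pairing): a generator of `ℤ/k` is a rational point of order `k = #E(ℚ)_tors`; in the second case
`(1, 0)` is a rational point of order `2k` and `#E(ℚ)_tors = 4k = 2·(2k)`.
[cite: CremonaAlgorithms1997, §3.3 p. 52] -/
theorem exists_torsionOrder_eq_addOrderOf_or :
    ∃ P : W.toAffine.Point, IsOfFinAddOrder P ∧
      (W.torsionOrder = addOrderOf P ∨ W.torsionOrder = 2 * addOrderOf P) := by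
  rw [torsionOrder_eq_natCard_torsion]
  have hC : torsion_addEquiv_zmod_or_prod W := torsion_addEquiv_zmod_or_prod_holds W
  obtain ⟨k, hk, h⟩ := hC
  rcases h with ⟨⟨e⟩⟩ | ⟨⟨e⟩⟩
  · -- cyclic case: a generator
    set x : AddCommGroup.torsion W.toAffine.Point := e.symm 1 with hx
    have hord : addOrderOf (x : W.toAffine.Point) = k := by
      rw [AddSubgroup.addOrderOf_coe, hx, AddEquiv.addOrderOf_eq, ZMod.addOrderOf_one]
    refine ⟨x, ?_, Or.inl ?_⟩
    · rw [← addOrderOf_pos_iff, hord]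
      exact hk
    · rw [hord, Nat.card_congr e.toEquiv, Nat.card_zmod]
  · -- `ℤ/2k × ℤ/2`: the point `(1, 0)` of order `2k`
    set x : AddCommGroup.torsion W.toAffine.Point := e.symm (1, 0) with hx
    have hord : addOrderOf (x : W.toAffine.Point) = 2 * k := by
      rw [AddSubgroup.addOrderOf_coe, hx, AddEquiv.addOrderOf_eq, Prod.addOrderOf_mk,
        ZMod.addOrderOf_one, addOrderOf_zero, Nat.lcm_one_right]
    refine ⟨x, ?_, Or.inr ?_⟩
    · rw [← addOrderOf_pos_iff, hord]
      omega
    · rw [hord, Nat.card_congr e.toEquiv, Nat.card_prod, Nat.card_zmod, Nat.card_zmod]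
      ring

/-! ### Unconditional: annihilators of the rational torsion -/

/-- **An annihilator `n` of `E(ℚ)_tors` gives `#E(ℚ)_tors ∣ 2n`.** If `n·P = O` for every rational
torsion point `P` (e.g. `n = #Ẽ(𝔽_ℓ)` at a good odd prime `ℓ`, Silverman AEC VII.3.1(b), or a gcd
of such), then `#E(ℚ)_tors ∣ 2n`: `#E(ℚ)_tors = m` or `2m` with `m` the order of a torsion point
(`exists_torsionOrder_eq_addOrderOf_or`), and `m ∣ n`. [cite: SilvermanAEC2009, VII.3.1(b)]
[cite: CremonaAlgorithms1997, §3.3 p. 52] -/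
theorem torsionOrder_dvd_two_mul_of_nsmul_eq_zero {n : ℕ}
    (h : ∀ P : W.toAffine.Point, IsOfFinAddOrder P → n • P = 0) : W.torsionOrder ∣ 2 * n := by
  obtain ⟨P, hP, hT⟩ := exists_torsionOrder_eq_addOrderOf_or W
  have hd : addOrderOf P ∣ n := addOrderOf_dvd_of_nsmul_eq_zero (h P hP)
  rcases hT with hT | hT <;> rw [hT]
  · exact hd.trans (dvd_mul_left n 2)
  · exact mul_dvd_mul_left 2 hd

/-- **At an odd prime `p`, `ord_p #E(ℚ)_tors ≤ ord_p n` for any annihilator `n ≠ 0` of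
`E(ℚ)_tors`** (`#E(ℚ)_tors ∣ 2n`). [cite: SilvermanAEC2009, VII.3.1(b)] -/
theorem padicValNat_torsionOrder_le_of_nsmul_eq_zero {n : ℕ} (hn : n ≠ 0) (p : ℕ)
    [hp : Fact p.Prime] (hp2 : p ≠ 2)
    (h : ∀ P : W.toAffine.Point, IsOfFinAddOrder P → n • P = 0) :
    padicValNat p W.torsionOrder ≤ padicValNat p n := by
  have hdvd := torsionOrder_dvd_two_mul_of_nsmul_eq_zero W h
  have h2n : 2 * n ≠ 0 := by omega
  calc padicValNat p W.torsionOrder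
      ≤ padicValNat p (2 * n) := (padicValNat_dvd_iff_le h2n).mp (pow_padicValNat_dvd.trans hdvd)
    _ = padicValNat p n := padicValNat_two_mul_of_ne_two hp2 hn

/-- **An odd prime annihilator with a witness point pins `#E(ℚ)_tors`.** If `p` is an odd prime with
`p·P = O` for every rational torsion point `P`, and some rational `T ≠ O` has `p·T = O`, then
`#E(ℚ)_tors = p`: `p ∣ #E(ℚ)_tors ∣ 2p` and `#E(ℚ)_tors` is a power of `p` (a finite group killed by
`p`; tree `TorsionAux.exists_card_eq_prime_pow`). This is the soundness statement of a «`ℤ/p`»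
torsion certificate (killers `#Ẽ(𝔽_ℓ)` with gcd `p`, Silverman AEC VII.3.1(b), plus the point `T`).
[cite: SilvermanAEC2009, VII.3.1(b)] [cite: CremonaAlgorithms1997, §3.3] -/
theorem torsionOrder_eq_of_prime_nsmul_eq_zero (p : ℕ) [hp : Fact p.Prime] (hp2 : p ≠ 2)
    (h : ∀ P : W.toAffine.Point, IsOfFinAddOrder P → p • P = 0)
    {T : W.toAffine.Point} (hT : p • T = 0) (hT0 : T ≠ 0) : W.torsionOrder = p := by
  have hup : W.torsionOrder ∣ 2 * p := torsionOrder_dvd_two_mul_of_nsmul_eq_zero W h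
  have hlow : p ∣ W.torsionOrder := dvd_torsionOrder_of_nsmul_eq_zero W p hT hT0
  -- `#E(ℚ)_tors` is a power of `p`
  haveI := finite_torsion_rat W
  obtain ⟨k, hk⟩ := TorsionAux.exists_card_eq_prime_pow
    (G := AddCommGroup.torsion W.toAffine.Point) (p := p) (e := 1) hp.out (fun x => by
      rw [pow_one]
      exact Subtype.ext (by
        rw [AddSubgroupClass.coe_nsmul, ZeroMemClass.coe_zero]
        exact h x x.2))
  rw [← torsionOrder_eq_natCard_torsion] at hk
  rw [hk] at hup hlow ⊢
  -- `p ∣ p^k ∣ 2p` with `p` odd forces `k = 1`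
  rcases k with _ | _ | k
  · rw [pow_zero, Nat.dvd_one] at hlow
    exact absurd hlow hp.out.one_lt.ne'
  · simp
  · exfalso
    have hsq : p * p ∣ 2 * p := (Dvd.intro (p ^ k) (by ring) : p * p ∣ p ^ (k + 1 + 1)).trans hup
    have hp2' : p ∣ 2 := Nat.dvd_of_mul_dvd_mul_right hp.out.pos hsq
    exact hp2 ((Nat.prime_dvd_prime_iff_eq hp.out Nat.prime_two).mp hp2')

/-! ### From Mazur's theorem (order form `Mazur1977_addOrderOf_le`, Thm. (7')) -/

/-- **`#E(ℚ)_tors = m` or `2m` with `m ≤ 10` or `m = 12`**, granted Mazur's Thm. (7')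
(`Mazur1977_addOrderOf_le W`: every rational torsion point has order `≤ 10` or `= 12`), applied to
the torsion point of `exists_torsionOrder_eq_addOrderOf_or`.
[cite: Mazur1977, Thm. (7') p. 35 and Cor. III.(5.2) p. 156] -/
theorem exists_torsionOrder_eq_of_mazur (hMz : Mazur1977_addOrderOf_le W) :
    ∃ m : ℕ, (m ≤ 10 ∨ m = 12) ∧ 0 < m ∧
      (W.torsionOrder = m ∨ W.torsionOrder = 2 * m) := by
  obtain ⟨P, hP, h⟩ := exists_torsionOrder_eq_addOrderOf_or W
  exact ⟨addOrderOf P, hMz P hP, hP.addOrderOf_pos, h⟩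

/-- **`#E(ℚ)_tors ≤ 24`** from Mazur's Thm. (7') alone (the fifteen-group form gives `≤ 16`, with
Kubert's exclusions of `ℤ/2 × ℤ/10`, `ℤ/2 × ℤ/12`; not needed by the consumers below).
[cite: Mazur1977, Thm. (7') p. 35] -/
theorem torsionOrder_le_of_mazur (hMz : Mazur1977_addOrderOf_le W) : W.torsionOrder ≤ 24 := by
  obtain ⟨m, hm, -, h⟩ := exists_torsionOrder_eq_of_mazur W hMz
  rcases h with h | h <;> omega

/-- **`p² ∤ #E(ℚ)_tors` for every prime `p ≥ 5`**, granted Mazur's Thm. (7')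
(`#E(ℚ)_tors ≤ 24 < 25 ≤ p²`). This discharges the binder «`¬ p ^ 2 ∣ W.torsionOrder`» of the
`Rank1Residual` files from the single named fact `Mazur1977_addOrderOf_le W`.
[cite: Mazur1977, Thm. (7') p. 35 and Cor. III.(5.2) p. 156] -/
theorem not_sq_dvd_torsionOrder_of_mazur (hMz : Mazur1977_addOrderOf_le W) {p : ℕ} (h5 : 5 ≤ p) :
    ¬ p ^ 2 ∣ W.torsionOrder := by
  intro hdvd
  have hle : p ^ 2 ≤ W.torsionOrder := Nat.le_of_dvd W.torsionOrder_pos_holds hdvd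
  have h25 : 5 ^ 2 ≤ p ^ 2 := Nat.pow_le_pow_left h5 2
  have h24 := torsionOrder_le_of_mazur W hMz
  omega

/-- **`ord_p #E(ℚ)_tors ≤ 1` for every prime `p ≥ 5`**, granted Mazur's Thm. (7').
[cite: Mazur1977, Thm. (7') p. 35 and Cor. III.(5.2) p. 156] -/
theorem padicValNat_torsionOrder_le_one_of_mazur (hMz : Mazur1977_addOrderOf_le W) (p : ℕ)
    [Fact p.Prime] (h5 : 5 ≤ p) : padicValNat p W.torsionOrder ≤ 1 :=
  padicValNat_le_one_of_not_sq_dvd (W.torsionOrder_pos_holds).ne'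
    (not_sq_dvd_torsionOrder_of_mazur W hMz h5)

/-- **`ord_3 #E(ℚ)_tors ≤ 2`**, granted Mazur's Thm. (7') (`#E(ℚ)_tors ≤ 24 < 27`).
[cite: Mazur1977, Thm. (7') p. 35 and Cor. III.(5.2) p. 156] -/
theorem padicValNat_three_torsionOrder_le_two_of_mazur (hMz : Mazur1977_addOrderOf_le W) :
    padicValNat 3 W.torsionOrder ≤ 2 :=
  padicValNat_le_of_lt_pow (W.torsionOrder_pos_holds).ne'
    (lt_of_le_of_lt (torsionOrder_le_of_mazur W hMz) (by norm_num))

/-- **`ord_2 #E(ℚ)_tors ≤ 4`**, granted Mazur's Thm. (7') (`#E(ℚ)_tors ≤ 24 < 32`).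
[cite: Mazur1977, Thm. (7') p. 35 and Cor. III.(5.2) p. 156] -/
theorem padicValNat_two_torsionOrder_le_four_of_mazur (hMz : Mazur1977_addOrderOf_le W) :
    padicValNat 2 W.torsionOrder ≤ 4 :=
  padicValNat_le_of_lt_pow (W.torsionOrder_pos_holds).ne'
    (lt_of_le_of_lt (torsionOrder_le_of_mazur W hMz) (by norm_num))

/-- **No prime `p ≥ 11` divides `#E(ℚ)_tors`**, granted Mazur's Thm. (7'): Cauchy's theorem in
`E(ℚ)_tors` would give a rational point of order `p`, and `p ≤ 10` or `p = 12` is absurd.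
[cite: Mazur1977, Thm. (7') p. 35 and Cor. III.(5.2) p. 156] -/
theorem not_dvd_torsionOrder_of_mazur (hMz : Mazur1977_addOrderOf_le W) {p : ℕ} (hp : p.Prime)
    (h11 : 11 ≤ p) : ¬ p ∣ W.torsionOrder := by
  intro hdvd
  haveI : Fact p.Prime := ⟨hp⟩
  haveI := finite_torsion_rat W
  rw [torsionOrder_eq_natCard_torsion] at hdvd
  obtain ⟨t, ht⟩ := exists_prime_addOrderOf_dvd_card' p hdvd
  have ht' : addOrderOf (t : W.toAffine.Point) = p := (AddSubgroup.addOrderOf_coe t).trans ht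
  have hfin : IsOfFinAddOrder (t : W.toAffine.Point) :=
    addOrderOf_pos_iff.mp (by rw [ht']; exact hp.pos)
  have h := hMz (t : W.toAffine.Point) hfin
  rw [ht'] at h
  rcases h with h | h
  · omega
  · rw [h] at hp
    rcases hp.eq_one_or_self_of_dvd 2 (by norm_num) with h2 | h2 <;> omega

/-- **A prime `p ≥ 5` and a rational `T ≠ O` with `p·T = O` give `ord_p #E(ℚ)_tors = 1`**, granted
Mazur's Thm. (7') (`≤ 1` from `not_sq_dvd_torsionOrder_of_mazur`, `≥ 1` from the point). This is the
torsion input of the cell's «ℤ/5» w16-bound rows: with the certified order-`5` point as reducibility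
witness, Wuthrich's bound reads `ord_5 #Ш[5^∞] ≤ k + 2·ord_5 #E(ℚ)_tors = k + 2`.
[cite: Mazur1977, Thm. (7') p. 35 and Cor. III.(5.2) p. 156] [cite: Wuthrich2014, Thm. 16 (p. 397)] -/
theorem padicValNat_torsionOrder_eq_one_of_mazur_of_nsmul_eq_zero (hMz : Mazur1977_addOrderOf_le W)
    (p : ℕ) [Fact p.Prime] (h5 : 5 ≤ p) {T : W.toAffine.Point} (hT : p • T = 0) (hT0 : T ≠ 0) :
    padicValNat p W.torsionOrder = 1 :=
  le_antisymm (padicValNat_torsionOrder_le_one_of_mazur W hMz p h5)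
    (one_le_padicValNat_torsionOrder_of_nsmul_eq_zero W p hT hT0)

end Literature.NumberTheory.EllipticCurves

end
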